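import Summits.AnomalousDissipation.AnomalousDissipation.Theorems.SawtoothPulseCascadeK1LocalisedCascadeLineRefineCascade
import Summits.AnomalousDissipation.AnomalousDissipation.Theorems.SawtoothPulseCascadeK1LocalisedCascadeChordSum

/-!
# K1loc, line `Spectral` — S-D (first good piece): THE CHORD EXPONENTIAL SUM OF THE INVISCID ITERATE

Helper file of the prover lane on the crux `K1LocalisedCascade` (stmt-AnomalousDissipation-19491), route
`SawtoothPulseCascade`, registered line `Cruxes.K1LocalisedCascade.Spectral` (one open stub `stub_highModeConcentration`).
`…ChordSum.norm_chord_integral_le` on the refined chord of `…LineRefineCascade.lineRefine_cascade`: the phase of the inviscid iterate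
along the chord `s ↦ Y + s e₀` is `φ(s) = (z_s 0)₀` (`…PlanarLink.iterate_proj_eq_sin`); on a leaf of the refinement it is affine with
slope `(itinJac γ L_i)₀₀`, `|slope| ≥ (γ²−3)^n`, up to `E_V` (`…PieceAffine.norm_traj_sub_sub_itinJac_le`), so for `|m| < (γ²−3)^n`:

* `continuous_traj` — `s ↦ z_s j` is continuous;
* `chord_sum_le` — `‖∫₀¹ sin(2π(z_s 0)₀) e^{−2πims} ds‖ ≤ B_n/(π(1 − |m|(γ²−3)^{−n})) + 2πE_V + |NEAR_Y ∩ [0,1]|`,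
  `NEAR_Y` = the parameters at which some input of some phase is within `M₁δ_j/(2πN_j) + E` of a corner.

WHAT THIS IS NOT: the measure of `NEAR_Y` (next file: a section of a small torus set). [cite: ElgindiLissMattingly2025, §1.2.2, §3.1]
[problem: turb]
-/

-- `Summit.<Summit>.<Problem>`: single-conjunct summit, the duplicate namespace segment is deliberate.
set_option linter.dupNamespace false

noncomputable section

namespace Summit.AnomalousDissipation.AnomalousDissipation.Theorems.SawtoothPulseCascade.K1Start

open Set Matrix Function MeasureTheory Complex
open Literature.Analysis Literature.Analysis.FunctionSpaces Literature.Analysis.FunctionSpaces.Torus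
open Literature.Analysis.FluidPDE.ShearStage
open Literature.Analysis.FluidPDE.SawtoothCascade Literature.Analysis.FluidPDE.SawtoothCascade.CascadeParams

section Cascade

variable (P : CascadeParams)

/-- The backward trajectories of the chord depend continuously on the parameter. [folklore] -/
theorem continuous_traj (hδ₀ : 0 < P.δ₀) (hd : 0 < P.d) {n : ℕ} (Y : EuclideanSpace ℝ (Fin 2))
    (z : ℝ → ℕ → EuclideanSpace ℝ (Fin 2)) (hzn : ∀ s, z s n = Y + s • EuclideanSpace.single 0 1)
    (hz : ∀ s, ∀ j < n, z s j = shearMapLift 0 1 (amp ⟨P.U j, P.U_periodic j, P.contDiff_U (P.δ_pos hδ₀ hd j)⟩ P.γ)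
      (shearMapLift 1 0 (amp ⟨P.U j, P.U_periodic j, P.contDiff_U (P.δ_pos hδ₀ hd j)⟩ P.γ) (z s (j + 1))))
    {j : ℕ} (hj : j ≤ n) : Continuous fun s => z s j := by
  have key : ∀ d j, j + d = n → Continuous fun s => z s j := by
    intro d
    induction d with
    | zero =>
      intro j hj
      rw [add_zero] at hj
      subst hj
      rw [show (fun s => z s j) = fun s => Y + s • EuclideanSpace.single 0 1 from funext hzn]
      fun_prop
    | succ d ih =>
      intro j hj
      have hc := ih (j + 1) (by omega)
      rw [show (fun s => z s j) = fun s => shearMapLift 0 1 (amp ⟨P.U j, P.U_periodic j, P.contDiff_U (P.δ_pos hδ₀ hd j)⟩ P.γ)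
        (shearMapLift 1 0 (amp ⟨P.U j, P.U_periodic j, P.contDiff_U (P.δ_pos hδ₀ hd j)⟩ P.γ) (z s (j + 1)))
        from funext fun s => hz s j (by omega)]
      exact (contDiff_shearMapLift _ _ _).continuous.comp ((contDiff_shearMapLift _ _ _).continuous.comp hc)
  exact key (n - j) j (by omega)

/-- **The chord exponential sum of the inviscid iterate** (`…ChordSum.norm_chord_integral_le` on the refinement of
`…LineRefineCascade.lineRefine_cascade`): for `|m| < (γ²−3)^n`,
`‖∫₀¹ sin(2π(z_s 0)₀) e^{−2πims} ds‖ ≤ B_n/(π(1 − |m|/(γ²−3)^n)) + 2πE_V + |NEAR_Y ∩ [0, 1]|`.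
[cite: ElgindiLissMattingly2025, §1.2.2, §3.1] -/
theorem chord_sum_le (hγ : 1 ≤ P.γ) (h8 : 8 ≤ P.γ ^ 2) (hδ₀ : 0 < P.δ₀) (hd : 0 < P.d) (hN₀ : 1 ≤ P.N₀) (hρ : 1 ≤ P.ρN)
    {M₁ M₂ : ℝ} (hM₁ : 0 < M₁) (hM : 1 ≤ M₂) (hMδ : ∀ j, M₂ * P.δ j < Real.pi / 2) {n : ℕ} (Y : EuclideanSpace ℝ (Fin 2))
    (z : ℝ → ℕ → EuclideanSpace ℝ (Fin 2)) (hzn : ∀ s, z s n = Y + s • EuclideanSpace.single 0 1)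
    (hz : ∀ s, ∀ j < n, z s j = shearMapLift 0 1 (amp ⟨P.U j, P.U_periodic j, P.contDiff_U (P.δ_pos hδ₀ hd j)⟩ P.γ)
      (shearMapLift 1 0 (amp ⟨P.U j, P.U_periodic j, P.contDiff_U (P.δ_pos hδ₀ hd j)⟩ P.γ) (z s (j + 1))))
    {EV EH : ℝ} (B : ℕ → ℝ) (hEV0 : 0 ≤ EV)
    (hEV : ∀ ℓ, ℓ ≤ n → (∑ i ∈ Finset.range ℓ, (1 + P.γ + P.γ ^ 2) ^ i *
        ((P.γ ^ 2 * (1 / (2 * P.N (n - ℓ + i)) - M₂ * P.δ (n - ℓ + i) / (Real.pi * P.N (n - ℓ + i))) +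
          P.γ * (1 / (2 * P.N (n - ℓ + i)) - M₂ * P.δ (n - ℓ + i) / (Real.pi * P.N (n - ℓ + i)))) *
          (2 * Real.exp (-(M₂ ^ 2 / 2))))) ≤ EV)
    (hEH : (1 + P.γ) * EV + P.γ * (2 * Real.exp (-(M₂ ^ 2 / 2))) * ((1 + P.γ + P.γ ^ 2) ^ n + EV) ≤ EH)
    (hζV : ∀ j, M₂ * P.δ j / (2 * Real.pi * P.N j) + EV ≤ M₁ * P.δ j / (2 * Real.pi * P.N j))
    (hζH : ∀ j, M₂ * P.δ j / (2 * Real.pi * P.N j) + EH ≤ M₁ * P.δ j / (2 * Real.pi * P.N j))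
    (hB0 : ((P.γ ^ 2 - 3) ^ n)⁻¹ ≤ B 0)
    (hB : ∀ ℓ, ℓ < n → 4 * B ℓ + 2 * P.N (n - ℓ - 1) * (P.γ + 2 + 2 / P.γ) / (P.γ ^ 2 - 3) ^ (n - ℓ) ≤ B (ℓ + 1))
    {m : ℝ} (hm : |m| < (P.γ ^ 2 - 3) ^ n) :
    ‖∫ s in (0 : ℝ)..1, (Real.sin (2 * Real.pi * (z s 0) 0) : ℂ) * exp (-(2 * Real.pi * I * (m * s)))‖ ≤
      B n / (Real.pi * (1 - |m| / (P.γ ^ 2 - 3) ^ n)) + 2 * Real.pi * EV +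
        (volume ({s : ℝ | ∃ j', j' < n ∧ ∃ q : ℤ,
          |(z s (j' + 1)) 0 - ((q : ℝ) / 2 + 1 / 4) / P.N j'| < M₁ * P.δ j' / (2 * Real.pi * P.N j') + EV ∨
          |((z s (j' + 1)) 1 - P.γ * P.U j' ((z s (j' + 1)) 0)) - ((q : ℝ) / 2 + 1 / 4) / P.N j'| <
            M₁ * P.δ j' / (2 * Real.pi * P.N j') + EH} ∩ Icc (0 : ℝ) 1)).toReal := by
  have hγ0 : 0 < P.γ := by linarith
  obtain ⟨ι, S, u, v, pV, pH, hpiece, hdisj, hlen, hgood, hpot, hcover⟩ :=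
    lineRefine_cascade P hγ h8 hδ₀ hd hN₀ hρ hM₁ hM hMδ Y z hzn hz B (fun ℓ hℓ => hEV ℓ hℓ.le) hEH hζV hζH hB0 hB
  have hφ : Continuous fun s => (z s 0) 0 :=
    (EuclideanSpace.proj (0 : Fin 2)).continuous.comp (continuous_traj P hδ₀ hd Y z hzn hz (Nat.zero_le n))
  -- normalise the level-`n` data: `n - n = 0`
  have hEVn := hEV n le_rfl
  simp only [Nat.sub_self, zero_add, pow_zero, one_mul] at hgood hpot hcover hEVn
  have hsl : ∀ i, IsSignList ((List.range n).map fun k =>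
      (-(1 - 2 * ((pH i k % 2 : ℤ) : ℝ)), -(1 - 2 * ((pV i k % 2 : ℤ) : ℝ)))) ∧
      ((List.range n).map fun k => (-(1 - 2 * ((pH i k % 2 : ℤ) : ℝ)), -(1 - 2 * ((pV i k % 2 : ℤ) : ℝ)))).length = n := by
    intro i
    have h := isSignList_pieceItin (pV i) (pH i) 0 n
    simp only [zero_add] at h
    exact h
  refine norm_chord_integral_le hφ S u v
    (fun i => itinJac P.γ ((List.range n).map fun k =>
      (-(1 - 2 * ((pH i k % 2 : ℤ) : ℝ)), -(1 - 2 * ((pV i k % 2 : ℤ) : ℝ)))) 0 0)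
    hEV0 hm hpiece hdisj hlen ?_ ?_ hpot _ ?_
  · -- affinity on a leaf
    intro i hi s hs s' hs'
    have htraj := norm_traj_sub_sub_itinJac_le P hγ hδ₀ hd hN₀ hρ hM hMδ (Nat.zero_le n) Y z hzn hz (pV i) (pH i)
      (fun t ht j h0 hj => hgood i hi t ht j h0 hj) hs hs'
    simp only [Nat.sub_zero, zero_add] at htraj
    exact (abs_coord_sub_sub_le_of_norm_le htraj 0).trans hEVn
  · -- slopes
    intro i _
    have h := (slopes_piece hγ0 h8 (hsl i).1).1
    rw [(hsl i).2] at h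
    exact h
  · -- cover
    intro s hs
    rcases hcover s hs with h | ⟨j', _, hj', q, hq⟩
    · exact Or.inl h
    · exact Or.inr ⟨j', hj', q, hq⟩

end Cascade

end Summit.AnomalousDissipation.AnomalousDissipation.Theorems.SawtoothPulseCascade.K1Start
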